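import Summits.CriticalPhenomena.PercolationContinuityZ3.Theorems.Transplant.SiteMetaA2
import Summits.CriticalPhenomena.PercolationContinuityZ3.Theorems.Transplant.SiteSetMarkov
import HarnessLib

/-!
# SITE percolation: `Y_F` is antitone in the source set (from `Y_F({u}) ≤ F` and the Markov property), and META-A2 with the
# one-source hypotheses only (WP4 of P1-SITE-Z3 §12; site twin of `CovTauMetaA2Anti` / `CovTauA2Anti`)

builds on p205010 (kernel theorem, internal audit signed; external expert review pending).

* `sC_eq_sC_srest_of_not_mem` — for `u ∉ C_N`, the cluster of `u` in `U` is its cluster in the site world `srest U N` (a path from `u`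
  cannot touch `C_N`, its closed boundary, or a closed source);
* `setC_insert_of_mem / _of_not_mem`, `srest_insert_of_not_mem` — adding one source;
* **`Yw_insert_le`**, **`Yw_antitone_of_le`** — `Y_F(N ∪ {u}) ≤ Y_F(N)` from `Y_F({u}) ≤ F(U')` in every sub-world, by conditioning on the
  value of `C_N` (`SiteBHK.sum_cond_setC`, p212269);
* **`metaA2`**, **`metaP1`** — the site two-source inequality and its diagonal (the (Htw) shape) from (★^F) and `Y_F({u}) ≤ F` only.
Support file (`--supports stmt-CriticalPhenomena-4575 --as helper`); no definitions, no named facts, no sorries.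
[cite: VandenbergHaggstromKahn2005, Thm. 1.1 (pp. 3–5), §1 pp. 7–8] [cite: KozmaNitzan2024, Conj. 1 (p. 3)]
-/

noncomputable section

namespace Summit.CriticalPhenomena.PercolationContinuityZ3.Theorems.Transplant

namespace SiteCovTau

open Literature.Probability.Percolation
open Literature.Probability.Percolation.BHK2006 (weight weight_nonneg)
open Literature.Probability.Percolation.DecisionTree (ind ind_of_mem ind_of_not_mem ind_nonneg)
open SiteBHK (sC sD sS setC srest deadOf adj_iff mem_srest mem_setC setC_subset setC_mono_set srest_subset not_mem_setC_iff
  sC_mono_set sum_cond_setC srest_eq_filter sD_antitone)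
open scoped Classical

variable {V : Type*} {Γ : SimpleGraph V}

/-! ### One more source vertex -/

/-- Vertices joined inside `U` have the same cluster. [folklore] -/
theorem sC_eq_of_mem {U : Finset V} {ω : Set V} {z u : V} (hu : u ∈ sC Γ U z ω) : sC Γ U u ω = sC Γ U z ω := by
  obtain ⟨hz, huo, hr⟩ := hu
  ext y
  constructor
  · rintro ⟨_, hy, hry⟩; exact ⟨hz, hy, hr.trans hry⟩
  · rintro ⟨_, hy, hry⟩; exact ⟨huo, hy, hr.symm.trans hry⟩

/-- **For `u ∉ C_N`, the cluster of `u` in `U` is its cluster in the site world `srest U N`.** [folklore] -/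
theorem sC_eq_sC_srest_of_not_mem {U : Finset V} {N : Set V} {ω : Set V} {u : V} (hu : u ∉ setC Γ U N ω) :
    sC Γ U u ω = sC Γ (srest Γ U N ω) u ω := by
  refine Set.Subset.antisymm ?_ (sC_mono_set (srest_subset U N ω) u ω)
  rintro y ⟨⟨huo, huU⟩, ⟨hyo, hyU⟩, hr⟩
  have huU : u ∈ U := huU
  -- every vertex on an open `U`-path from `u` lies in the world
  have key : ∀ c, (siteOpenGraph Γ (ω ∩ ↑U)).Reachable u c → c ∈ ω → c ∈ U → c ∈ srest Γ U N ω := by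
    intro c hc hco hcU
    rw [mem_srest]
    have hcC : c ∉ setC Γ U N ω := fun ⟨z, hz, hcz⟩ =>
      hu ⟨z, hz, by rw [← sC_eq_of_mem hcz]; exact ⟨⟨hco, hcU⟩, ⟨huo, huU⟩, hc.symm⟩⟩
    refine ⟨hcU, fun hcN => hcC ⟨c, hcN, ⟨hco, hcU⟩, ⟨hco, hcU⟩, SimpleGraph.Reachable.refl c⟩, hcC, fun d hd hcd => hcC ?_⟩
    obtain ⟨z, hz, hdz⟩ := hd
    obtain ⟨hzo, ⟨hdo, hdU⟩, hzd⟩ := hdz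
    exact ⟨z, hz, hzo, ⟨hco, hcU⟩, hzd.trans (SimpleGraph.Adj.reachable (adj_iff.2 ⟨hcd.symm, ⟨hdo, hdU⟩, ⟨hco, hcU⟩⟩))⟩
  have huR := key u (SimpleGraph.Reachable.refl u) huo huU
  refine ⟨⟨huo, huR⟩, ⟨hyo, key y hr hyo hyU⟩, ?_⟩
  rw [SimpleGraph.reachable_iff_reflTransGen] at hr ⊢
  clear hyo hyU
  induction hr with
  | refl => exact Relation.ReflTransGen.refl
  | @tail b c hab hbc ih =>
    obtain ⟨hadj, ⟨hbo, hbU⟩, ⟨hco, hcU⟩⟩ := adj_iff.1 hbc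
    have hb := key b ((SimpleGraph.reachable_iff_reflTransGen _ _).2 hab) hbo hbU
    have hc := key c (((SimpleGraph.reachable_iff_reflTransGen _ _).2 hab).trans hbc.reachable) hco hcU
    exact ih.tail (adj_iff.2 ⟨hadj, ⟨hbo, hb⟩, ⟨hco, hc⟩⟩)

/-- If `u ∈ C_N` then `C_{N ∪ {u}} = C_N`. [folklore] -/
theorem setC_insert_of_mem {U : Finset V} {N : Set V} {ω : Set V} {u : V} (hu : u ∈ setC Γ U N ω) :
    setC Γ U (insert u N) ω = setC Γ U N ω := by
  refine Set.Subset.antisymm ?_ (setC_mono_set U (Set.subset_insert u N) ω)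
  rintro a ⟨z, rfl | hz, ha⟩
  · obtain ⟨z', hz', hu'⟩ := hu
    exact ⟨z', hz', by rw [← sC_eq_of_mem hu']; exact ha⟩
  · exact ⟨z, hz, ha⟩

/-- If `u ∉ C_N` then `C_{N ∪ {u}} = C_N ∪ C^{srest}_u`. [folklore] -/
theorem setC_insert_of_not_mem {U : Finset V} {N : Set V} {ω : Set V} {u : V} (hu : u ∉ setC Γ U N ω) :
    setC Γ U (insert u N) ω = setC Γ U N ω ∪ sC Γ (srest Γ U N ω) u ω := by
  ext a
  rw [Set.mem_union, ← sC_eq_sC_srest_of_not_mem hu]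
  constructor
  · rintro ⟨z, rfl | hz, ha⟩
    · exact Or.inr ha
    · exact Or.inl ⟨z, hz, ha⟩
  · rintro (⟨z, hz, ha⟩ | ha)
    · exact ⟨z, Set.mem_insert_of_mem u hz, ha⟩
    · exact ⟨u, Set.mem_insert u N, ha⟩

/-- The cluster of a one-point source set. [folklore] -/
theorem setC_singleton (U' : Finset V) (u : V) (ω : Set V) : setC Γ U' ({u} : Set V) ω = sC Γ U' u ω := by
  ext a
  simp only [mem_setC, Set.mem_singleton_iff, exists_eq_left]

/-- If `u ∉ C_N` then the world of `N ∪ {u}` is the world of `{u}` inside the world of `N`. [folklore] -/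
theorem srest_insert_of_not_mem {U : Finset V} {N : Set V} {ω : Set V} {u : V} (hu : u ∉ setC Γ U N ω) :
    srest Γ U (insert u N) ω = srest Γ (srest Γ U N ω) ({u} : Set V) ω := by
  ext a
  rw [mem_srest, mem_srest, mem_srest, setC_insert_of_not_mem hu, setC_singleton]
  simp only [Set.mem_union, Set.mem_insert_iff, Set.mem_singleton_iff, not_or]
  constructor
  · rintro ⟨haU, ⟨hau, haN⟩, ⟨haC, haCu⟩, hadj⟩
    exact ⟨⟨haU, haN, haC, fun c hc => hadj c (Or.inl hc)⟩, hau, haCu, fun c hc => hadj c (Or.inr hc)⟩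
  · rintro ⟨⟨haU, haN, haC, hadjC⟩, hau, haCu, hadju⟩
    refine ⟨haU, ⟨hau, haN⟩, ⟨haC, haCu⟩, ?_⟩
    rintro c (hc | hc)
    exacts [hadjC c hc, hadju c hc]

/-- The world only reads the states inside it. [folklore] -/
theorem srest_inter (U' : Finset V) (M : Set V) (ω : Set V) : srest Γ U' M (ω ∩ ↑U') = srest Γ U' M ω := by
  have h : setC Γ U' M (ω ∩ ↑U') = setC Γ U' M ω := by
    simp only [setC, SiteBHK.sC_inter U' _ _ (↑U') subset_rfl]
  ext a; rw [mem_srest, mem_srest, h]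

/-- Avoidance events only read the states inside the world. [folklore] -/
theorem mem_sD_inter (U' : Finset V) (s : V) (M : Set V) (ω : Set V) : ω ∩ ↑U' ∈ sD Γ U' s M ↔ ω ∈ sD Γ U' s M :=
  SiteBHK.mem_sD_inter U' s M ω (↑U') subset_rfl

variable [Fintype V]

/-- **Adding a source vertex decreases `Y_F`** (site): if `Y_F({u}) ≤ F` in every sub-world `U' ⊆ U`, then `Y_F(N ∪ {u}) ≤ Y_F(N)`.
[cite: VandenbergHaggstromKahn2005, §1 pp. 7–8] -/
theorem Yw_insert_le (q : V → ℝ) (hq0 : ∀ a, 0 ≤ q a) (hq1 : ∀ a, q a ≤ 1)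
    (hm : ∑ ω, weight q ω = 1) (x : V) (F : Finset V → ℝ) (U : Finset V)
    (hYB : ∀ U' ⊆ U, ∀ u : V, Yw Γ q U' x F {u} ≤ F U') (N : Set V) (u : V) :
    Yw Γ q U x F (insert u N) ≤ Yw Γ q U x F N := by
  -- the integrand of `Y(N ∪ {u})` as a function of `(C_N, ω ∩ srest)`
  set R : Set V → Finset V := fun W => U.filter fun a => a ∉ deadOf Γ N W with hR
  set Φ : Set V → Set V → ℝ := fun W η =>
    ind {W : Set V | x ∉ W} W * (if u ∈ W then F (R W) else F (srest Γ (R W) ({u} : Set V) η) * ind (sD Γ (R W) x ({u} : Set V)) η)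
    with hΦ
  have hRW : ∀ ω : Set V, R (setC Γ U N ω) = srest Γ U N ω := fun ω => (srest_eq_filter U N ω).symm
  have hxW : ∀ ω : Set V, ind {W : Set V | x ∉ W} (setC Γ U N ω) = ind (sD Γ U x N) ω := by
    intro ω
    by_cases h : x ∈ setC Γ U N ω
    · rw [ind_of_not_mem (show setC Γ U N ω ∉ {W : Set V | x ∉ W} from fun h' => h' h),
        ind_of_not_mem (fun h' => ((not_mem_setC_iff U N ω x).2 h') h)]
    · rw [ind_of_mem (show setC Γ U N ω ∈ {W : Set V | x ∉ W} from h), ind_of_mem ((not_mem_setC_iff U N ω x).1 h)]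
  have hint : ∀ ω : Set V, F (srest Γ U (insert u N) ω) * ind (sD Γ U x (insert u N)) ω =
      Φ (setC Γ U N ω) (ω ∩ ↑(srest Γ U N ω)) := by
    intro ω
    simp only [hΦ, hxW, hRW, srest_inter]
    by_cases hu : u ∈ setC Γ U N ω
    · rw [if_pos hu]
      have hC : setC Γ U (insert u N) ω = setC Γ U N ω := setC_insert_of_mem hu
      have hRe : srest Γ U (insert u N) ω = srest Γ U N ω := by
        ext a; rw [mem_srest, mem_srest, hC, Set.mem_insert_iff, not_or]
        constructor
        · rintro ⟨haU, ⟨-, haN⟩, h3, h4⟩; exact ⟨haU, haN, h3, h4⟩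
        · rintro ⟨haU, haN, h3, h4⟩; exact ⟨haU, ⟨fun h => h3 (h ▸ hu), haN⟩, h3, h4⟩
      rw [hRe]
      by_cases hx : ω ∈ sD Γ U x N
      · have hx' : ω ∈ sD Γ U x (insert u N) := by
          rw [← not_mem_setC_iff] at hx ⊢; rwa [hC]
        rw [ind_of_mem hx, ind_of_mem hx', mul_one, one_mul]
      · have hx' : ω ∉ sD Γ U x (insert u N) := fun h => hx (sD_antitone (Set.subset_insert u N) h)
        rw [ind_of_not_mem hx, ind_of_not_mem hx', mul_zero, zero_mul]
    · rw [if_neg hu, srest_insert_of_not_mem hu]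
      by_cases hx : ω ∈ sD Γ U x N
      · rw [ind_of_mem hx, one_mul]
        have hxC : x ∉ setC Γ U N ω := (not_mem_setC_iff U N ω x).2 hx
        have hiff : ω ∈ sD Γ U x (insert u N) ↔ ω ∩ ↑(srest Γ U N ω) ∈ sD Γ (srest Γ U N ω) x ({u} : Set V) := by
          rw [mem_sD_inter]
          simp only [sD, Set.mem_setOf_eq, Set.mem_insert_iff, Set.mem_singleton_iff, forall_eq_or_imp, forall_eq,
            ← sC_eq_sC_srest_of_not_mem hxC]
          exact ⟨fun h => h.1, fun h => ⟨h, hx⟩⟩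
        by_cases hx' : ω ∈ sD Γ U x (insert u N)
        · rw [ind_of_mem hx', ind_of_mem (hiff.1 hx')]
        · rw [ind_of_not_mem hx', ind_of_not_mem fun h => hx' (hiff.2 h)]
      · have hx' : ω ∉ sD Γ U x (insert u N) := fun h => hx (sD_antitone (Set.subset_insert u N) h)
        rw [ind_of_not_mem hx, ind_of_not_mem hx', mul_zero, zero_mul]
  -- condition on `C_N`; inside, the `u ∉ W` branch is `Y_{srest}({u}) ≤ F(srest)`
  have hdec := sum_cond_setC q hm U N Φ (Γ := Γ)
  unfold Yw
  simp_rw [hint]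
  rw [hdec]
  refine Finset.sum_le_sum fun ω _ => mul_le_mul_of_nonneg_left ?_ (weight_nonneg hq0 hq1 ω)
  simp only [hΦ, hRW]
  by_cases hu : u ∈ setC Γ U N ω
  · simp only [if_pos hu]
    rw [← Finset.sum_mul, hm, one_mul, hxW]
    exact (mul_comm _ _).le
  · simp only [if_neg hu, hxW]
    have hsum : ∑ ω', weight q ω' * (ind (sD Γ U x N) ω *
        (F (srest Γ (srest Γ U N ω) ({u} : Set V) (ω' ∩ ↑(srest Γ U N ω))) *
          ind (sD Γ (srest Γ U N ω) x ({u} : Set V)) (ω' ∩ ↑(srest Γ U N ω)))) =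
        ind (sD Γ U x N) ω * Yw Γ q (srest Γ U N ω) x F {u} := by
      unfold Yw
      rw [Finset.mul_sum]
      refine Finset.sum_congr rfl fun ω' _ => ?_
      rw [srest_inter]
      have : ind (sD Γ (srest Γ U N ω) x ({u} : Set V)) (ω' ∩ ↑(srest Γ U N ω)) =
          ind (sD Γ (srest Γ U N ω) x ({u} : Set V)) ω' := by
        by_cases h : ω' ∈ sD Γ (srest Γ U N ω) x ({u} : Set V)
        · rw [ind_of_mem h, ind_of_mem ((mem_sD_inter _ _ _ _).2 h)]
        · rw [ind_of_not_mem h, ind_of_not_mem fun h' => h ((mem_sD_inter _ _ _ _).1 h')]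
      rw [this]; ring
    rw [hsum, mul_comm (F (srest Γ U N ω))]
    exact mul_le_mul_of_nonneg_left (hYB _ (srest_subset U N ω) u) (ind_nonneg _ _)

/-- **`Y_F` is antitone in the source set** (site) given `Y_F({u}) ≤ F` in every sub-world. [cite: VandenbergHaggstromKahn2005, §1 pp. 7–8] -/
theorem Yw_antitone_of_le (q : V → ℝ) (hq0 : ∀ a, 0 ≤ q a) (hq1 : ∀ a, q a ≤ 1)
    (hm : ∑ ω, weight q ω = 1) (x : V) (F : Finset V → ℝ) (U : Finset V)
    (hYB : ∀ U' ⊆ U, ∀ u : V, Yw Γ q U' x F {u} ≤ F U') {N N' : Set V} (hNN' : N ⊆ N')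
    (hN'U : N' ⊆ ↑U) : Yw Γ q U x F N' ≤ Yw Γ q U x F N := by
  set D : Finset V := U.filter fun u => u ∈ N' ∧ u ∉ N with hD
  have hN' : N' = N ∪ ↑D := by
    ext u
    simp only [hD, Set.mem_union, Finset.coe_filter, Set.mem_setOf_eq]
    constructor
    · intro hu; by_cases huN : u ∈ N; exacts [Or.inl huN, Or.inr ⟨hN'U hu, hu, huN⟩]
    · rintro (hu | ⟨-, hu, -⟩); exacts [hNN' hu, hu]
  rw [hN']
  clear_value D
  clear hN' hD
  induction D using Finset.induction_on with
  | empty => simp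
  | @insert u D _ ih =>
    rw [Finset.coe_insert, Set.union_insert]
    exact (Yw_insert_le q hq0 hq1 hm x F U hYB _ u).trans ih

/-- **META-A2 (site) from the one-source bounds only**: (★^F) and `Y_F({u}) ≤ F` in every sub-world give
`E_A(N)·Y_F(N') ≤ M_A(N ∪ N')·X_F(N ∩ N')`. [cite: VandenbergHaggstromKahn2005, Thm. 1.1 (pp. 3–5)] -/
theorem metaA2 (q : V → ℝ) (hq0 : ∀ a, 0 ≤ q a) (hq1 : ∀ a, q a ≤ 1)
    (hm : ∑ ω, weight q ω = 1) (x o v : V) (A : Set V) {F : Finset V → ℝ}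
    (hF0 : ∀ U' : Finset V, 0 ≤ F U') (hFv : ∀ U' : Finset V, v ∉ U' → F U' = 0)
    (hFx : ∀ U' : Finset V, x ∉ U' → F U' = 0) (U : Finset V)
    (hstar : ∀ U' ⊆ U, ∀ N : Set V, N ⊆ ↑U' →
      Yw Γ q U' x F N * Mav Γ q U' A v ∅ ≤ Mav Γ q U' A v N * F U')
    (hYB : ∀ U' ⊆ U, ∀ u : V, Yw Γ q U' x F {u} ≤ F U') {N N' : Set V} (hNU : N ⊆ ↑U)
    (hN'U : N' ⊆ ↑U) :
    Eav Γ q U A o v N * Yw Γ q U x F N' ≤ Mav Γ q U A v (N ∪ N') * Xw Γ q U x A o v F (N ∩ N') :=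
  metaA2_of_star q hq0 hq1 hm x o v A hF0 hFv hFx U hstar
    (fun U' hU' _ _ hNN' hN'U' => Yw_antitone_of_le q hq0 hq1 hm x F U'
      (fun U'' hU'' => hYB U'' (hU''.trans hU')) hNN' hN'U') N N' hNU hN'U

/-- **The diagonal of META-A2 (site) from the one-source bounds only** — the shape of (Htw)_site.
[cite: VandenbergHaggstromKahn2005, Thm. 1.1 (pp. 3–5)] -/
theorem metaP1 (q : V → ℝ) (hq0 : ∀ a, 0 ≤ q a) (hq1 : ∀ a, q a ≤ 1)
    (hm : ∑ ω, weight q ω = 1) (x o v : V) (A : Set V) {F : Finset V → ℝ}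
    (hF0 : ∀ U' : Finset V, 0 ≤ F U') (hFv : ∀ U' : Finset V, v ∉ U' → F U' = 0)
    (hFx : ∀ U' : Finset V, x ∉ U' → F U' = 0) (U : Finset V) {Y : Set V} (hY : Y ⊆ ↑U)
    (hstar : ∀ U' ⊆ U, ∀ N : Set V, N ⊆ ↑U' →
      Yw Γ q U' x F N * Mav Γ q U' A v ∅ ≤ Mav Γ q U' A v N * F U')
    (hYB : ∀ U' ⊆ U, ∀ u : V, Yw Γ q U' x F {u} ≤ F U') :
    Eav Γ q U A o v Y * Yw Γ q U x F Y ≤ Mav Γ q U A v Y * Xw Γ q U x A o v F Y := by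
  have h := metaA2 q hq0 hq1 hm x o v A hF0 hFv hFx U hstar hYB (N := Y) (N' := Y) hY hY
  simpa only [Set.union_self, Set.inter_self] using h

end SiteCovTau

end Summit.CriticalPhenomena.PercolationContinuityZ3.Theorems.Transplant
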